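import Summits.BirchSwinnertonDyer.BirchSwinnertonDyer.Theorems.PrintCFramBottomClassIndexLawFiveLeParitySplitPrimitivityFieldFactor
import Summits.BirchSwinnertonDyer.BirchSwinnertonDyer.Theorems.PrintCFramBottomClassIndexLawFiveLeGenusInternalHeegnerSeven
import Summits.BirchSwinnertonDyer.BirchSwinnertonDyer.Theorems.PrintCFramBottomClassIndexLawFiveLeKrizLiBinders
import HarnessLib

/-!
# Crux `PrintCFram.BottomClassIndexLawFiveLe` (stmt-BirchSwinnertonDyer-20372), line `eisenstein-resource-bdp-line` (registry v26),
# genus-internal branch of `stub_seedOffExc`, IDENTITY ROAD — (GI-5) THE Ш-BINDER OF THE TWIST: `Ш(W)[7] = 0` for every globally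
# minimal `W ≅ X₀(49)^{(d_K)}` of analytic rank `≤ 1` over a `7`-REGULAR imaginary quadratic `K`
# (cell `bsd-print-cfram`, width seat `bsd-line-cfram-p1-w4` g19; THEOREMS ONLY, `--supports` 20372; BSD is not proved by any of this)

HONEST FRAMING. THEOREMS ONLY (0 defs / 0 facts / 0 sorry); nothing about BSD is proved unconditionally; no registered stub is closed;
no summit statement is proved by this seat; the crux stays OPEN and is NOT claimed false. This file discharges exactly ONE binder of
the identity road of the genus-internal branch (critic V#146b; w3 g16 `…GenusInternalIndexIdentity` / `…GenusInternalDisplay`, GI-4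
«Ш-input»): the hypothesis `h0W : ∀ x : W.sha, (7:ℤ) • x = 0 → x = 0` for the RANK-ONE twist `W ≅ X₀(49)^{(d_K)}` of a `7`-regular
imaginary quadratic `K` (w3 g16, HOME STATUS 2026-08-29T06:48:16Z: «left as a binder for the router unless cheap here»). It is cheap:
pure by-name plumbing of landed theorems of this cell.

* §1 (prime- and curve-generic) **`sha_noPTorsion_twist_of_unit_fieldFactor_of_analyticRank_le_one`**: for a class member `V`
  (CM, `p ≥ 5` CM-ramified) with an ODD datum `(f, ψ, ω)` and trace form `hss`, an IMAGINARY quadratic `K` (no Heegner hypothesis,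
  any parity of `d_K`) with Kronecker `ε_K` and UNIT FIELD FACTOR `¬ ‖B_{1,(ψε_Kω⁻¹)~}‖_p ≤ p⁻¹`, and any globally minimal
  `W ≅ V^{(d_K)}` with `r_an(W) ≤ 1`: `Ш(W/ℚ)[p] = 0`, granting Cassels–Tate and GZK. Proof: `W` is a class member
  (`ParitySplit.hasCM_and_cmRamified_of_smul_quadraticTwist`) with its own odd datum (`OffLocusDictionary.exists_krizLiTriple_odd_of_cmRamified`)
  whose CLASS factor is the `K`-factor of `(V, K)` (w3 g7 `OffLocusTwistFactor.classFactor_twist_eq_fieldFactor`), a unit; then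
  `#Sel_p(W/ℚ) ≤ p` ((α′) `LevelDictionaryAlpha.natCard_selmerGroup_le_of_unit_classFactor`) and Cassels–Tate in analytic rank `0`
  (`ParitySplit.noPTorsion_of_natCard_selmerGroup_le_of_analyticRank_zero`) or `1` (`ParitySplit.noPTorsion_of_unit_classFactor_of_analyticRank_one`).
  (w3 g9's `ParitySplit.noPTorsion_twist_of_unit_fieldFactor` is the rank-`0` case read through `L(V^{(d_K)},1) ≠ 0`; here the twist may
  carry the rank — the genus-internal orientation.)
* §2 at `(V, p) = (X₀(49), 7)`: **`not_norm_fieldFactor_cm7_le_inv_of_regular`** (the `K`-factor of `(cm7, K)` at ANY datum with `hss`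
  is a `7`-unit as soon as the class is REGULAR, `7 ∤ B_{5,χ}/5`, `χ` primitive mod `m ⊥ 7` agreeing with `ε_K` off a finite set —
  w6 g8 `bernoulli_hypothesis_cm7_of_regular` at `ψ = ω²`, rigidity `OffLocusDictionary.bernoulliFour_iff_of_hss`, and `p`-integrality
  `BernoulliUnits.norm_bernoulliPair_le_one_of_hss` to split the product), and the three consumer-facing forms of `h0W`:
  **`sha_noSevenTorsion_twist_cm7_of_regular`** (`χ`-currency with the values bridge), **`…_classDatum`** (the registry's spelling
  `((7 − 2 : ℕ) : ℚ_[7])⁻¹ * generalizedBernoulli (7 − 2) χ` of `stub_seedOffExc`), **`…_kronecker`** (`χ := ε_K`), `…_heegner`.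
* §3 the same in the EXACT binder shapes of w3 g16's end state (HOME STATUS 2026-08-29T06:57:55Z): model binder
  `C • W = cm7.quadraticTwist d_K` (variable change on the `W` side), cast `((7 : ℕ) : ℤ) • x`, `W.analyticRank = 1` —
  **`sha_noSevenTorsion_of_regular_of_smul_eq_twist_cm7`** (`χ`-currency, `7 ∤ d_K`), `…_heegner` (level binder
  `cm7.conductorNorm ℤ = N`, `SatisfiesHeegnerHypothesis N K`), `…_kronecker_…_heegner` (`χ := ε_K`).

What §2 needs of `K`: imaginary quadratic and `7 ∤ d_K` (true for every Heegner field of `X₀(49)` and for the strippings `ℚ(√−3)`,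
`ℚ(i)` of critic V#146 (ii)); NO Heegner hypothesis, NO `d_K < −4`, NO parity. beyond-print theorem: NO (bookkeeping of landed sockets).
References: Kriz–Li 2019 Thm. 1.20, §2, §7.1; Cassels 1962 (IV); Bhargava–Skinner 2014 Lemma 16; Washington §5.1, Thm. 5.11, Cor. 5.13;
crux workfiles `Lines/eisenstein-resource-bdp-line-w3g16-notes.md` §3b, `…-w6g8-notes.md`, `…-w7g7-notes.md`.
-/

set_option autoImplicit false
-- `…BirchSwinnertonDyer.BirchSwinnertonDyer.Theorems…` is the problem's mandated namespace (D-0017).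
set_option linter.dupNamespace false

noncomputable section

open scoped Classical

open WeierstrassCurve NumberField DirichletCharacter
open Literature.NumberTheory Literature.NumberTheory.EllipticCurves
  Literature.NumberTheory.EllipticCurves.ModularForms
  Literature.NumberTheory.EllipticCurves.Rank1Residual
  Literature.NumberTheory.EllipticCurves.Rank1Residual.Typed
  Literature.NumberTheory.EllipticCurves.KrizLi2019 Literature.NumberTheory.LFunctions
open Summit.BirchSwinnertonDyer.Rank1Residual
open Summit.BirchSwinnertonDyer.BirchSwinnertonDyer.Theorems
open Summit.BirchSwinnertonDyer.BirchSwinnertonDyer.Theorems.SchneiderFree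
open Summit.BirchSwinnertonDyer.BirchSwinnertonDyer.Theorems.GoldfeldGoodTwists

namespace Summit.BirchSwinnertonDyer.BirchSwinnertonDyer.Theorems.PrintCFram.GenusInternal

open Summit.BirchSwinnertonDyer.BirchSwinnertonDyer.Theorems.PrintCFram

/-! ## §1 Prime- and curve-generic: a unit `K`-factor kills `Ш[p]` of the twist in analytic rank `≤ 1` -/

/-- **`Ш(W/ℚ)[p] = 0` for a twist `W ≅ V^{(d_K)}` of analytic rank `≤ 1` from a UNIT `K`-FACTOR.** Let `V/ℚ` be elliptic with CM,
`p ≥ 5` CM-ramified, `(f, ψ, ω)` an ODD datum (`ψ(−1) = −1`, `ω` Teichmüller) with the trace form `hss` for `V`, `K` an imaginary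
quadratic field with Kronecker character `ε_K` and UNIT field factor `¬ ‖B_{1,(ψε_Kω⁻¹)~}‖_p ≤ p⁻¹`, and `W` any globally minimal model of
the twist `V^{(d_K)}` with `ord_{s=1} L(W,s) ≤ 1`. Then, granting Cassels–Tate and GZK: every `x ∈ Ш(W/ℚ)` with `p·x = 0` is `0`.
The twist is a class member with its own odd datum `(f', ψ', ω')`; its class factor `B_{1,ψ'⁻¹}` IS the `K`-factor of `(V, K)`
(`OffLocusTwistFactor.classFactor_twist_eq_fieldFactor`), a unit, so `#Sel_p(W/ℚ) ≤ p` and Cassels–Tate closes in rank `0` and in rank `1`.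
No Heegner hypothesis on `K`, any parity of `d_K`. CONDITIONAL on `hCT`, `hGZK`; closes no stub.
[cite: KrizLi2019, Thm. 1.20 (p. 8), §2 (p. 11) and §7.1 (p. 43)] [cite: Cassels1962ArithmeticIV] [cite: BhargavaSkinner2014, proof of Lemma 16] -/
theorem sha_noPTorsion_twist_of_unit_fieldFactor_of_analyticRank_le_one {p : ℕ} [hp : Fact p.Prime]
    (hCT : exists_casselsTate_pairing (K := ℚ)) (hGZK : rank_eq_analyticRank_of_analyticRank_le_one)
    (V : WeierstrassCurve ℚ) [V.IsElliptic] (hCM : V.HasCM) (hram : CMRamified V p) (h5 : 5 ≤ p)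
    {f : ℕ} [NeZero f] (ψ : DirichletCharacter ℚ_[p] f) (ω : DirichletCharacter ℚ_[p] p)
    (hψ : ψ.Odd) (hω : IsTeichmullerCharacter ω)
    (hss : ∀ ℓ : ℕ, ℓ.Prime → ¬ (ℓ ∣ p * V.conductorNorm ℤ) →
      ‖((V.LFunction ℓ : ℤ) : ℚ_[p]) - (ψ (ℓ : ZMod f) + ψ⁻¹ (ℓ : ZMod f) * ω (ℓ : ZMod p))‖ < 1)
    (K : Type) [Field K] [NumberField K] (hK : IsImaginaryQuadratic K)
    (εK : DirichletCharacter ℚ_[p] (NumberField.discr K).natAbs) (hεK : IsKroneckerCharacterOf K εK)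
    (hfld : ¬ ‖bernoulliOnePrim (bernoulliCharTwo ψ εK ω)‖ ≤ (p : ℝ)⁻¹)
    (W : WeierstrassCurve ℚ) [W.IsElliptic] [W.IsGloballyMinimal]
    (hW : ∃ C : VariableChange ℚ, C • V.quadraticTwist (NumberField.discr K : ℚ) = W) (hrW : W.analyticRank ≤ 1) :
    ∀ x : W.sha, (p : ℤ) • x = 0 → x = 0 := by
  have hD0 : (NumberField.discr K : ℚ) ≠ 0 := by exact_mod_cast NumberField.discr_ne_zero K
  obtain ⟨hCMW, hramW⟩ := ParitySplit.hasCM_and_cmRamified_of_smul_quadraticTwist V hCM hram hD0 W hW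
  -- the twist's own odd datum
  obtain ⟨f', hf', ψ', ω', -, -, hψ', hω', hss', -, -, -, -⟩ :=
    OffLocusDictionary.exists_krizLiTriple_odd_of_cmRamified W p hCMW hramW h5 K hK.1
  haveI := hf'
  -- the same trace form read on the literal twist `V.quadraticTwist d_K`
  obtain ⟨C, hC⟩ := hW
  haveI : (V.quadraticTwist (NumberField.discr K : ℚ)).IsElliptic := V.isElliptic_quadraticTwist hD0
  have hssX : ∀ ℓ : ℕ, ℓ.Prime → ¬ (ℓ ∣ p * (V.quadraticTwist (NumberField.discr K : ℚ)).conductorNorm ℤ) →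
      ‖(((V.quadraticTwist (NumberField.discr K : ℚ)).LFunction ℓ : ℤ) : ℚ_[p]) -
        (ψ' (ℓ : ZMod f') + ψ'⁻¹ (ℓ : ZMod f') * ω' (ℓ : ZMod p))‖ < 1 := by
    intro ℓ hℓ hℓN
    have hN : W.conductorNorm ℤ = (V.quadraticTwist (NumberField.discr K : ℚ)).conductorNorm ℤ := by
      rw [← hC]; exact conductorNorm_smul_rat (V.quadraticTwist (NumberField.discr K : ℚ)) C
    have hL : W.LFunction = (V.quadraticTwist (NumberField.discr K : ℚ)).LFunction := by
      rw [← hC]; exact LFunction_smul (V.quadraticTwist (NumberField.discr K : ℚ)) C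
    have h := hss' ℓ hℓ (by rw [hN]; exact hℓN)
    rw [hL] at h
    exact h
  -- the class factor of the twist is the `K`-factor of `(V, K)`, a unit
  have hcls' : ¬ ‖bernoulliOnePrim ψ'⁻¹‖ ≤ (p : ℝ)⁻¹ := by
    rw [OffLocusTwistFactor.classFactor_twist_eq_fieldFactor V h5 ψ ω hψ hω hss K hK εK hεK ψ' ω' hψ' hω' hssX]
    exact hfld
  rcases Nat.le_one_iff_eq_zero_or_eq_one.mp hrW with hr0 | hr1
  · -- analytic rank `0`: (α′) and Cassels–Tate
    exact ParitySplit.noPTorsion_of_natCard_selmerGroup_le_of_analyticRank_zero W p hCT hGZK hr0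
      (LevelDictionaryAlpha.natCard_selmerGroup_le_of_unit_classFactor W p hCMW hramW h5 ψ' ω' hψ' hω' hss' hcls')
  · -- analytic rank `1`: w3 g9's Kriz–Li-locus theorem
    exact ParitySplit.noPTorsion_of_unit_classFactor_of_analyticRank_one hCT hGZK W hCMW hramW h5 hr1 ψ' ω' hψ' hω' hss' hcls'

/-! ## §2 At `(X₀(49), 7)`: regularity of the class makes the `K`-factor a unit, hence `Ш(W)[7] = 0` for the twist -/

/-- **The `K`-factor of `(X₀(49), K)` is a `7`-unit on a REGULAR class, at ANY datum.** Let `K` be imaginary quadratic with `7 ∤ d_K`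
and Kronecker character `ε_K` (mod `|d_K|`, `ℚ₇`-valued), `χ` a PRIMITIVE character mod `m ⊥ 7` agreeing with `ε_K` at every prime
`ℓ ∤ N₀`, REGULAR: `7 ∤ B_{5,χ}/5`. Then for every datum `(f, ψ, ω')` (either parity) with `ω'` Teichmüller and the trace form `hss`
for `cm7 = 49a1`: `¬ ‖B_{1,(ψ₀ω'⁻¹)~}‖₇ ≤ 7⁻¹` for Kriz–Li's second character `bernoulliCharTwo ψ ε_K ω'`. Proof: w6 g8's
`bernoulli_hypothesis_cm7_of_regular` gives Thm. 1.20's product (4) at `ψ = ω'²`; the product is the same at every datum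
(`OffLocusDictionary.bernoulliFour_iff_of_hss`, with bsd-goldfeld's `hss_cm7_teichmuller_sq`); both factors are `7`-integral
(`BernoulliUnits.norm_bernoulliPair_le_one_of_hss`, `7 ∤ d_K`), so the second is a unit.
[cite: KrizLi2019, Thm. 1.20 (p. 8, the Bernoulli hypothesis) and §7.1 (p. 43)] [cite: Washington1997, §5.1, Thm. 5.11 and Cor. 5.13] -/
theorem not_norm_fieldFactor_cm7_le_inv_of_regular
    (K : Type) [Field K] [NumberField K] (h7d : ¬ (7 : ℤ) ∣ NumberField.discr K)
    (εK : DirichletCharacter ℚ_[7] (NumberField.discr K).natAbs) (hεK : IsKroneckerCharacterOf K εK)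
    {m : ℕ} [NeZero m] (χ : DirichletCharacter ℚ_[7] m) (hχ : χ.IsPrimitive) (hm7 : m.Coprime 7)
    {N₀ : ℕ} (hN₀ : N₀ ≠ 0)
    (hχε : ∀ ℓ : ℕ, ℓ.Prime → ¬ ℓ ∣ N₀ → χ (ℓ : ZMod m) = εK (ℓ : ZMod (NumberField.discr K).natAbs))
    (hreg : ¬ ‖(5 : ℚ_[7])⁻¹ * generalizedBernoulli 5 χ‖ ≤ (7 : ℝ)⁻¹)
    {f : ℕ} [NeZero f] (ψ : DirichletCharacter ℚ_[7] f) (ω' : DirichletCharacter ℚ_[7] 7)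
    (hω' : IsTeichmullerCharacter ω')
    (hss : ∀ ℓ : ℕ, ℓ.Prime → ¬ (ℓ ∣ 7 * cm7.conductorNorm ℤ) →
      ‖((cm7.LFunction ℓ : ℤ) : ℚ_[7]) - (ψ (ℓ : ZMod f) + ψ⁻¹ (ℓ : ZMod f) * ω' (ℓ : ZMod 7))‖ < 1) :
    ¬ ‖bernoulliOnePrim (bernoulliCharTwo ψ εK ω')‖ ≤ (7 : ℝ)⁻¹ := by
  haveI h7 : Fact (Nat.Prime 7) := ⟨by norm_num⟩
  haveI : NeZero (NumberField.discr K).natAbs := ⟨Int.natAbs_ne_zero.mpr (NumberField.discr_ne_zero K)⟩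
  have hCM : cm7.HasCM := hasCM_cm7'
  have hram : CMRamified cm7 7 := KrizLiBinders.cmRamified_bases.1
  have h7d' : ¬ 7 ∣ (NumberField.discr K).natAbs := fun h => h7d (Int.natCast_dvd.mpr h)
  -- (4) at `ψ = ω'²` from regularity (w6 g8), transported to the datum `(ψ, ω')` (rigidity of the Bernoulli product)
  have h4 := bernoulli_hypothesis_cm7_of_regular ω' hω' εK χ hχ hm7 hN₀ hχε hreg
  have h4ψ : ¬ (‖bernoulliOnePrim (bernoulliCharOne ψ εK) * bernoulliOnePrim (bernoulliCharTwo ψ εK ω')‖ ≤ (7 : ℝ)⁻¹) :=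
    fun h => h4 ((OffLocusDictionary.bernoulliFour_iff_of_hss cm7 (by norm_num) K ψ (ω' ^ 2) ω' ω' εK εK hω' hω' hss
      (hss_cm7_teichmuller_sq ω' hω') hεK hεK).mp h)
  -- both factors are `7`-integral, so the second is a unit
  obtain ⟨ha, -⟩ := BernoulliUnits.norm_bernoulliPair_le_one_of_hss cm7 hCM hram (by norm_num) hω' ψ hss εK h7d'
  intro hb
  apply h4ψ
  rw [norm_mul]
  calc ‖bernoulliOnePrim (bernoulliCharOne ψ εK)‖ * ‖bernoulliOnePrim (bernoulliCharTwo ψ εK ω')‖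
      ≤ 1 * (7 : ℝ)⁻¹ := mul_le_mul ha hb (norm_nonneg _) zero_le_one
    _ = (7 : ℝ)⁻¹ := one_mul _

/-- **(GI-5) `h0W` DISCHARGED — `Ш(W/ℚ)[7] = 0` for every globally minimal `W ≅ X₀(49)^{(d_K)}` of analytic rank `≤ 1` over a
`7`-REGULAR imaginary quadratic `K` (`χ`-currency).** Let `K` be imaginary quadratic with `7 ∤ d_K` (e.g. any Heegner field of `X₀(49)`,
or `ℚ(√−3)`, `ℚ(i)`), `ε_K` its Kronecker character, `χ` PRIMITIVE mod `m ⊥ 7` agreeing with `ε_K` at the primes `ℓ ∤ N₀` (e.g.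
`χ = ε_K`, or the class character `χ_{e*}` mod `|e*|` when `K = ℚ(√e*)` is the twisting field), REGULAR (`¬ ‖5⁻¹·B_{5,χ}‖₇ ≤ 7⁻¹`),
and `W/ℚ` globally minimal with `C • cm7.quadraticTwist d_K = W` and `ord_{s=1} L(W,s) ≤ 1`. Then, granting Cassels–Tate and GZK:
every `x ∈ Ш(W/ℚ)` with `7·x = 0` is `0`. This is exactly the binder `h0W` of the identity-road end state of the genus-internal branch
(w3 g16 `bsdp_twist_cm7_of_regular_of_sha_twist`); with w3 g16's GI-4 (`Ш(X₀(49))[7] = 0`, the quadratic base-change decomposition)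
it gives the Ш-input `padicValNat 7 (cm7.baseChange K).shaOrder = 0` WITHOUT any `L`-value of `49a1`. Proof: §1 at `V = cm7` with its
abstract odd datum (`OffLocusDictionary.exists_krizLiTriple_odd_of_cmRamified`) and the unit `K`-factor of §2. CONDITIONAL on `hCT`,
`hGZK`; closes no stub; BSD is not proved by any of this. [cite: KrizLi2019, Thm. 1.20 (pp. 7–8), Rem. 1.21 (p. 8), §7.1 (p. 43)]
[cite: Cassels1962ArithmeticIV] [cite: BhargavaSkinner2014, proof of Lemma 16] [cite: Washington1997, Thm. 5.11 and Cor. 5.13] -/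
theorem sha_noSevenTorsion_twist_cm7_of_regular
    (hCT : exists_casselsTate_pairing (K := ℚ)) (hGZK : rank_eq_analyticRank_of_analyticRank_le_one)
    (K : Type) [Field K] [NumberField K] (hK : IsImaginaryQuadratic K) (h7d : ¬ (7 : ℤ) ∣ NumberField.discr K)
    (εK : DirichletCharacter ℚ_[7] (NumberField.discr K).natAbs) (hεK : IsKroneckerCharacterOf K εK)
    {m : ℕ} [NeZero m] (χ : DirichletCharacter ℚ_[7] m) (hχ : χ.IsPrimitive) (hm7 : m.Coprime 7)
    {N₀ : ℕ} (hN₀ : N₀ ≠ 0)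
    (hχε : ∀ ℓ : ℕ, ℓ.Prime → ¬ ℓ ∣ N₀ → χ (ℓ : ZMod m) = εK (ℓ : ZMod (NumberField.discr K).natAbs))
    (hreg : ¬ ‖(5 : ℚ_[7])⁻¹ * generalizedBernoulli 5 χ‖ ≤ (7 : ℝ)⁻¹)
    (W : WeierstrassCurve ℚ) [W.IsElliptic] [W.IsGloballyMinimal]
    (hW : ∃ C : VariableChange ℚ, C • cm7.quadraticTwist (NumberField.discr K : ℚ) = W) (hrW : W.analyticRank ≤ 1) :
    ∀ x : W.sha, (7 : ℤ) • x = 0 → x = 0 := by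
  haveI h7 : Fact (Nat.Prime 7) := ⟨by norm_num⟩
  have hCM : cm7.HasCM := hasCM_cm7'
  have hram : CMRamified cm7 7 := KrizLiBinders.cmRamified_bases.1
  -- an odd datum of `cm7` at `7`
  obtain ⟨f, hf, ψ, ω', -, -, hψ, hω', hss, -, -, -, -⟩ :=
    OffLocusDictionary.exists_krizLiTriple_odd_of_cmRamified cm7 7 hCM hram (by norm_num) K hK.1
  haveI := hf
  have hfld := not_norm_fieldFactor_cm7_le_inv_of_regular K h7d εK hεK χ hχ hm7 hN₀ hχε hreg ψ ω' hω' hss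
  have h := sha_noPTorsion_twist_of_unit_fieldFactor_of_analyticRank_le_one (p := 7) hCT hGZK cm7 hCM hram (by norm_num) ψ ω'
    hψ hω' hss K hK εK hεK hfld W hW hrW
  exact_mod_cast h

/-- **`h0W` in the REGISTRY'S spelling of regularity** (`stub_seedOffExc`: `¬ ‖((p − k : ℕ) : ℚ_[p])⁻¹ * generalizedBernoulli (p − k) χ‖ ≤ p⁻¹`
at `(p, k) = (7, 2)`): `Ш(W/ℚ)[7] = 0` for every globally minimal `W ≅ X₀(49)^{(d_K)}` of analytic rank `≤ 1`, `K` imaginary quadratic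
with `7 ∤ d_K`, class character `χ` agreeing with `ε_K` off `N₀`. CONDITIONAL on `hCT`, `hGZK`; closes no stub.
[cite: KrizLi2019, Thm. 1.20 (pp. 7–8) and §7.1 (p. 43)] [cite: Cassels1962ArithmeticIV] -/
theorem sha_noSevenTorsion_twist_cm7_of_regular_classDatum
    (hCT : exists_casselsTate_pairing (K := ℚ)) (hGZK : rank_eq_analyticRank_of_analyticRank_le_one)
    (K : Type) [Field K] [NumberField K] (hK : IsImaginaryQuadratic K) (h7d : ¬ (7 : ℤ) ∣ NumberField.discr K)
    (εK : DirichletCharacter ℚ_[7] (NumberField.discr K).natAbs) (hεK : IsKroneckerCharacterOf K εK)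
    {m : ℕ} [NeZero m] (χ : DirichletCharacter ℚ_[7] m) (hχ : χ.IsPrimitive) (hm7 : m.Coprime 7)
    {N₀ : ℕ} (hN₀ : N₀ ≠ 0)
    (hχε : ∀ ℓ : ℕ, ℓ.Prime → ¬ ℓ ∣ N₀ → χ (ℓ : ZMod m) = εK (ℓ : ZMod (NumberField.discr K).natAbs))
    (hreg : ¬ ‖((7 - 2 : ℕ) : ℚ_[7])⁻¹ * generalizedBernoulli (7 - 2) χ‖ ≤ (7 : ℝ)⁻¹)
    (W : WeierstrassCurve ℚ) [W.IsElliptic] [W.IsGloballyMinimal]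
    (hW : ∃ C : VariableChange ℚ, C • cm7.quadraticTwist (NumberField.discr K : ℚ) = W) (hrW : W.analyticRank ≤ 1) :
    ∀ x : W.sha, (7 : ℤ) • x = 0 → x = 0 :=
  sha_noSevenTorsion_twist_cm7_of_regular hCT hGZK K hK h7d εK hεK χ hχ hm7 hN₀ hχε (by exact_mod_cast hreg) W hW hrW

/-- **`h0W` in KRONECKER currency (`χ := ε_K`): `Ш(W/ℚ)[7] = 0` for every globally minimal `W ≅ X₀(49)^{(d_K)}` of analytic rank `≤ 1`
over a `7`-REGULAR (`7 ∤ B_{5,ε_K}/5`) imaginary quadratic `K` with `7 ∤ d_K`**, granting Cassels–Tate and GZK. CONDITIONAL; closes no stub.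
[cite: KrizLi2019, Thm. 1.20 (pp. 7–8) and §7.1 (p. 43)] [cite: Cassels1962ArithmeticIV] -/
theorem sha_noSevenTorsion_twist_cm7_of_regular_kronecker
    (hCT : exists_casselsTate_pairing (K := ℚ)) (hGZK : rank_eq_analyticRank_of_analyticRank_le_one)
    (K : Type) [Field K] [NumberField K] (hK : IsImaginaryQuadratic K) (h7d : ¬ (7 : ℤ) ∣ NumberField.discr K)
    (εK : DirichletCharacter ℚ_[7] (NumberField.discr K).natAbs) (hεK : IsKroneckerCharacterOf K εK)
    (hreg : ¬ ‖(5 : ℚ_[7])⁻¹ * generalizedBernoulli 5 εK‖ ≤ (7 : ℝ)⁻¹)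
    (W : WeierstrassCurve ℚ) [W.IsElliptic] [W.IsGloballyMinimal]
    (hW : ∃ C : VariableChange ℚ, C • cm7.quadraticTwist (NumberField.discr K : ℚ) = W) (hrW : W.analyticRank ≤ 1) :
    ∀ x : W.sha, (7 : ℤ) • x = 0 → x = 0 := by
  haveI : NeZero (NumberField.discr K).natAbs := ⟨Int.natAbs_ne_zero.mpr (NumberField.discr_ne_zero K)⟩
  have h7d' : ¬ 7 ∣ (NumberField.discr K).natAbs := fun h => h7d (Int.natCast_dvd.mpr h)
  have hd7 : (NumberField.discr K).natAbs.Coprime 7 := ((Nat.Prime.coprime_iff_not_dvd (by norm_num)).mpr h7d').symm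
  exact sha_noSevenTorsion_twist_cm7_of_regular hCT hGZK K hK h7d εK hεK εK hεK.1 hd7 one_ne_zero (fun _ _ _ => rfl) hreg W hW hrW

/-- **The same over a HEEGNER field of `X₀(49)` (the shape of the identity-road end state: `SatisfiesHeegnerHypothesis 49 K` instead of
`7 ∤ d_K`, analytic rank EQUAL to one).** For `K` imaginary quadratic Heegner for `49`, `7`-regular in Kronecker currency, and a globally
minimal `W ≅ X₀(49)^{(d_K)}` with `W.analyticRank = 1`: `Ш(W/ℚ)[7] = 0`, granting Cassels–Tate and GZK. CONDITIONAL; closes no stub.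
[cite: KrizLi2019, Thm. 1.20 (pp. 7–8) and Rem. 1.21 (p. 8)] [cite: GrossLMS1991, §1 (p. 235, Heegner hypothesis)] [cite: Cassels1962ArithmeticIV] -/
theorem sha_noSevenTorsion_twist_cm7_of_regular_heegner
    (hCT : exists_casselsTate_pairing (K := ℚ)) (hGZK : rank_eq_analyticRank_of_analyticRank_le_one)
    (K : Type) [Field K] [NumberField K] (hK : IsImaginaryQuadratic K) (hH : SatisfiesHeegnerHypothesis 49 K)
    (εK : DirichletCharacter ℚ_[7] (NumberField.discr K).natAbs) (hεK : IsKroneckerCharacterOf K εK)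
    (hreg : ¬ ‖(5 : ℚ_[7])⁻¹ * generalizedBernoulli 5 εK‖ ≤ (7 : ℝ)⁻¹)
    (W : WeierstrassCurve ℚ) [W.IsElliptic] [W.IsGloballyMinimal]
    (hW : ∃ C : VariableChange ℚ, C • cm7.quadraticTwist (NumberField.discr K : ℚ) = W) (hr : W.analyticRank = 1) :
    ∀ x : W.sha, (7 : ℤ) • x = 0 → x = 0 :=
  sha_noSevenTorsion_twist_cm7_of_regular_kronecker hCT hGZK K hK
    (Literature.SatisfiesHeegnerHypothesis.not_dvd_discr hK.1 hH (by norm_num) (by norm_num)) εK hεK hreg W hW hr.le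

/-! ## §3 `h0W` in the EXACT binder shapes of the identity-road end state (w3 g16 GI-4 §3 `bsdp_twist_cm7_of_regular_of_sha_twist`):
model binder `C • W = cm7.quadraticTwist d_K` (variable change on the `W` side), cast `((7 : ℕ) : ℤ) • x`, `W.analyticRank = 1` -/

/-- **`h0W` VERBATIM (`χ`-currency).** For `K` imaginary quadratic with `7 ∤ d_K`, Kronecker `ε_K`, a primitive `χ` mod `m ⊥ 7` agreeing
with `ε_K` off `N₀` and REGULAR (`¬ ‖5⁻¹·B_{5,χ}‖₇ ≤ 7⁻¹`), and `W/ℚ` globally minimal with `C • W = cm7.quadraticTwist d_K` and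
`W.analyticRank = 1`: **`∀ x : W.sha, ((7 : ℕ) : ℤ) • x = 0 → x = 0`**, granting Cassels–Tate and GZK — the binder `h0W` of w3 g16's
`bsdp_twist_cm7_of_regular_of_sha_twist` with its model binder `hW` and rank binder `hrW` in the same shapes (the variable change is
inverted by `inv_smul_eq_iff`). CONDITIONAL on `hCT`, `hGZK`; closes no stub. [cite: KrizLi2019, Thm. 1.20 (pp. 7–8) and §7.1 (p. 43)]
[cite: Cassels1962ArithmeticIV] [cite: BhargavaSkinner2014, proof of Lemma 16] -/
theorem sha_noSevenTorsion_of_regular_of_smul_eq_twist_cm7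
    (hCT : exists_casselsTate_pairing (K := ℚ)) (hGZK : rank_eq_analyticRank_of_analyticRank_le_one)
    (K : Type) [Field K] [NumberField K] (hK : IsImaginaryQuadratic K) (h7d : ¬ (7 : ℤ) ∣ NumberField.discr K)
    (εK : DirichletCharacter ℚ_[7] (NumberField.discr K).natAbs) (hεK : IsKroneckerCharacterOf K εK)
    {m : ℕ} [NeZero m] (χ : DirichletCharacter ℚ_[7] m) (hχ : χ.IsPrimitive) (hm7 : m.Coprime 7)
    {N₀ : ℕ} (hN₀ : N₀ ≠ 0)
    (hχε : ∀ ℓ : ℕ, ℓ.Prime → ¬ ℓ ∣ N₀ → χ (ℓ : ZMod m) = εK (ℓ : ZMod (NumberField.discr K).natAbs))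
    (hreg : ¬ ‖(5 : ℚ_[7])⁻¹ * generalizedBernoulli 5 χ‖ ≤ (7 : ℝ)⁻¹)
    (W : WeierstrassCurve ℚ) [W.IsElliptic] [W.IsGloballyMinimal]
    (hW : ∃ C : VariableChange ℚ, C • W = cm7.quadraticTwist (NumberField.discr K : ℚ)) (hrW : W.analyticRank = 1) :
    ∀ x : W.sha, ((7 : ℕ) : ℤ) • x = 0 → x = 0 := by
  obtain ⟨C, hC⟩ := hW
  have hW' : ∃ C' : VariableChange ℚ, C' • cm7.quadraticTwist (NumberField.discr K : ℚ) = W :=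
    ⟨C⁻¹, inv_smul_eq_iff.mpr hC.symm⟩
  have h := sha_noSevenTorsion_twist_cm7_of_regular hCT hGZK K hK h7d εK hεK χ hχ hm7 hN₀ hχε hreg W hW' hrW.le
  exact_mod_cast h

/-- **`h0W` VERBATIM over a HEEGNER field at the end state's level binder** (`hN : cm7.conductorNorm ℤ = N`, `SatisfiesHeegnerHypothesis N K`
— so `7 ∣ N` splits in `K` and `7 ∤ d_K`), `χ`-currency: `∀ x : W.sha, ((7 : ℕ) : ℤ) • x = 0 → x = 0` for every globally minimal `W` with
`C • W = cm7.quadraticTwist d_K` and `W.analyticRank = 1`, granting Cassels–Tate and GZK. CONDITIONAL; closes no stub.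
[cite: KrizLi2019, Thm. 1.20 (pp. 7–8) and Rem. 1.21 (p. 8)] [cite: GrossLMS1991, §1 (p. 235, Heegner hypothesis)] [cite: Cassels1962ArithmeticIV] -/
theorem sha_noSevenTorsion_of_regular_of_smul_eq_twist_cm7_heegner
    (hCT : exists_casselsTate_pairing (K := ℚ)) (hGZK : rank_eq_analyticRank_of_analyticRank_le_one)
    {N : ℕ} (hN : cm7.conductorNorm ℤ = N)
    (K : Type) [Field K] [NumberField K] (hK : IsImaginaryQuadratic K) (hH : SatisfiesHeegnerHypothesis N K)
    (εK : DirichletCharacter ℚ_[7] (NumberField.discr K).natAbs) (hεK : IsKroneckerCharacterOf K εK)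
    {m : ℕ} [NeZero m] (χ : DirichletCharacter ℚ_[7] m) (hχ : χ.IsPrimitive) (hm7 : m.Coprime 7)
    {N₀ : ℕ} (hN₀ : N₀ ≠ 0)
    (hχε : ∀ ℓ : ℕ, ℓ.Prime → ¬ ℓ ∣ N₀ → χ (ℓ : ZMod m) = εK (ℓ : ZMod (NumberField.discr K).natAbs))
    (hreg : ¬ ‖(5 : ℚ_[7])⁻¹ * generalizedBernoulli 5 χ‖ ≤ (7 : ℝ)⁻¹)
    (W : WeierstrassCurve ℚ) [W.IsElliptic] [W.IsGloballyMinimal]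
    (hW : ∃ C : VariableChange ℚ, C • W = cm7.quadraticTwist (NumberField.discr K : ℚ)) (hrW : W.analyticRank = 1) :
    ∀ x : W.sha, ((7 : ℕ) : ℤ) • x = 0 → x = 0 := by
  have hH49 : SatisfiesHeegnerHypothesis 49 K := by rw [← conductorNorm_cm7, hN]; exact hH
  exact sha_noSevenTorsion_of_regular_of_smul_eq_twist_cm7 hCT hGZK K hK
    (Literature.SatisfiesHeegnerHypothesis.not_dvd_discr hK.1 hH49 (by norm_num) (by norm_num)) εK hεK χ hχ hm7 hN₀ hχε hreg W hW hrW

/-- **`h0W` VERBATIM in KRONECKER currency** (`χ := ε_K`, regularity `¬ ‖5⁻¹·B_{5,ε_K}‖₇ ≤ 7⁻¹`) over a Heegner field at the end state's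
level binder: `∀ x : W.sha, ((7 : ℕ) : ℤ) • x = 0 → x = 0` for every globally minimal `W` with `C • W = cm7.quadraticTwist d_K` and
`W.analyticRank = 1`, granting Cassels–Tate and GZK. CONDITIONAL; closes no stub.
[cite: KrizLi2019, Thm. 1.20 (pp. 7–8) and Rem. 1.21 (p. 8)] [cite: Cassels1962ArithmeticIV] -/
theorem sha_noSevenTorsion_of_regular_kronecker_of_smul_eq_twist_cm7_heegner
    (hCT : exists_casselsTate_pairing (K := ℚ)) (hGZK : rank_eq_analyticRank_of_analyticRank_le_one)
    {N : ℕ} (hN : cm7.conductorNorm ℤ = N)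
    (K : Type) [Field K] [NumberField K] (hK : IsImaginaryQuadratic K) (hH : SatisfiesHeegnerHypothesis N K)
    (εK : DirichletCharacter ℚ_[7] (NumberField.discr K).natAbs) (hεK : IsKroneckerCharacterOf K εK)
    (hreg : ¬ ‖(5 : ℚ_[7])⁻¹ * generalizedBernoulli 5 εK‖ ≤ (7 : ℝ)⁻¹)
    (W : WeierstrassCurve ℚ) [W.IsElliptic] [W.IsGloballyMinimal]
    (hW : ∃ C : VariableChange ℚ, C • W = cm7.quadraticTwist (NumberField.discr K : ℚ)) (hrW : W.analyticRank = 1) :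
    ∀ x : W.sha, ((7 : ℕ) : ℤ) • x = 0 → x = 0 := by
  haveI : NeZero (NumberField.discr K).natAbs := ⟨Int.natAbs_ne_zero.mpr (NumberField.discr_ne_zero K)⟩
  have hH49 : SatisfiesHeegnerHypothesis 49 K := by rw [← conductorNorm_cm7, hN]; exact hH
  have h7d : ¬ (7 : ℤ) ∣ NumberField.discr K :=
    Literature.SatisfiesHeegnerHypothesis.not_dvd_discr hK.1 hH49 (by norm_num) (by norm_num)
  have h7d' : ¬ 7 ∣ (NumberField.discr K).natAbs := fun h => h7d (Int.natCast_dvd.mpr h)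
  have hd7 : (NumberField.discr K).natAbs.Coprime 7 := ((Nat.Prime.coprime_iff_not_dvd (by norm_num)).mpr h7d').symm
  exact sha_noSevenTorsion_of_regular_of_smul_eq_twist_cm7 hCT hGZK K hK h7d εK hεK εK hεK.1 hd7 one_ne_zero (fun _ _ _ => rfl)
    hreg W hW hrW

end Summit.BirchSwinnertonDyer.BirchSwinnertonDyer.Theorems.PrintCFram.GenusInternal

end
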